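import Summits.ValiantsHypothesis.ValiantsHypothesis.Theorems.KPlusLogSqLawTropicalBCarryCycleLex

/-!
# Route «KPlusLogSqLaw», crux `TropicalB` (stmt-ValiantsHypothesis-19771) — the SINGLE-CYCLE CARRY LAW in the lex sector:
# a full carry of a dominant chain is ONE cycle through all lower-digit columns; every invariant block is the carry or frozen

HONEST FRAMING.  Helper file toward the registered stub `stub_tropThin` (⟺ `TropicalB`, open) of
`Cruxes/TropicalB/Lines/birth.lean` (crux `Summit.ValiantsHypothesis.ValiantsHypothesis.Theses.KPlusLogSqLaw.TropicalB`, item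
`stmt-ValiantsHypothesis-19771`, route `KPlusLogSqLaw`; cell `pub-symmetroid`, seat val-sym-trop-p1 g3, 2026-08-26).  A STRUCTURE LAW
in the lex sector (exponent values super-increasing by the size) that every pair of dominant terms obeys; it proves NO part of the
stub and asserts nothing about `TropicalB` in its window, `WeakLifting`, `KPlusLogSqLaw`, `MatrixDescartes` (stmt-18050) or VP ≠ VNP.

THIS FILE (part 2 of 2) proves the laws; the counting toolkit and the lex form of the exchange principle are part 1
(`…TropicalBCarryCycleLex`, same namespace).

THE LAW.  Let `p` be the unique optimum at `θa` and `q` at `θb > θa` of one design `(d, v, ε)`, `d` super-increasing by the size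
(`d l < d l' → m·d l < d l'`).  Count columns by exponent VALUE: `cnt d J r D = #{i ∈ J : d (r i) = D}`.  Call a column set `W`
INVARIANT if `σ_p(W) = σ_q(W)` (a union of orbits of `σ_p⁻¹ σ_q`).  Suppose the profiles of `p` and `q` agree at every value above
`h` («leading value `h`»).
* `cnt_eq_above` — no invariant part changes a count above `h` (odometer locality, re-derived from the exchange principle
  `IntervalOpt.sl_lt_of_inOpt`);
* `not_both_lead` — if `q` has exactly ONE more column of value `h` than `p`, then of any invariant `W` and its complement at
  most one changes its count at `h` (the leading orbit is unique);
* `carry_dichotomy` — if moreover every column of `q` of value `< h` sits at the floor value `d₀ = min d` (a FULL CARRY into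
  `h`: one unit gained at `h`, everything below reset; this includes every unit step of the lowest digit, `h = d₁`), then for
  every invariant `W`: `p` and `q` agree (same row AND same class) on all of `W`, or on all of `Wᶜ`.  Corollaries: the changed
  columns lie in ONE orbit of `σ_p⁻¹σ_q` (`carry_single_orbit`), every other orbit is pointwise frozen; every column of `p`
  carrying a middle value (`d₀ < · < h`) changes (`middle_changes`), so the carry cycle threads ALL lower-digit columns of `p`
  and the column that gains `h`; an invariant block that misses one changed column is completely frozen (`carry_block_frozen`) —
  during a full carry no sub-register, parked gadget or second coupling can do anything on the side.
Design reading (cell memo CARRY-CYCLE.md of this seat): this is the exact obstruction that kills «D digits as multi-hole registers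
with private pairwise coupling blocks» (a reset would close inside the digit's own columns), and the reason the tree's
`CoupledRegister` works (two one-hole registers: the single coupling entry closes the two hole paths into one cycle).
PROOF.  Exchange principle on `W` and on `Wᶜ` (both invariant) gives `sl_W(p) < sl_W(q)`; with super-increasing values the top
value where the `W`-counts differ favours `q` (`lex_top`); a top above `h` on either side contradicts «equal above `h`» (take the
larger top), two tops at `h` contradict «+1 at `h`», a top below `h` is a value of `q` below `h`, i.e. the floor, where a strict
excess with equal counts above and nothing below contradicts `|W| = |W|`.
[folklore] parametric-assignment exchange arguments; the statements are the cell's (no citation exists).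
-/

set_option linter.dupNamespace false
set_option autoImplicit false

namespace Summit.ValiantsHypothesis.ValiantsHypothesis.Theorems.KPlusLogSqLaw

open Summit.ValiantsHypothesis.ValiantsHypothesis.Theorems.MatrixDescartes.Negative
open Finset

namespace CarryCycle

variable {m K : ℕ} {d : Fin K → ℕ} {v ε : Fin m → Fin m → Fin K → ℤ}

/-! ## 4. The three laws -/

/-- **NO INVARIANT PART CHANGES A COUNT ABOVE THE LEADING VALUE** (odometer locality, re-derived): if the global profiles of `p ≺ q`
agree at every value above `h`, then so do the profiles of every invariant column set. [folklore; statement of the cell] -/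
theorem cnt_eq_above (hlex : ∀ l l', d l < d l' → m * d l < d l') {θa θb : ℤ} (hab : θa < θb)
    {p q : Equiv.Perm (Fin m) × (Fin m → Fin K)} (hp : IsDominant d v ε θa p) (hq : IsDominant d v ε θb q)
    {h : ℕ} (habove : ∀ D, h < D → cnt d univ p.2 D = cnt d univ q.2 D)
    {W : Finset (Fin m)} (hW : W.image p.1 = W.image q.1) : ∀ D, h < D → cnt d W p.2 D = cnt d W q.2 D := by
  -- the key step, for an invariant set `A` whose top is above `h`: contradiction
  have key : ∀ {A : Finset (Fin m)}, A.image p.1 = A.image q.1 → ∀ D₀, h < D₀ → cnt d A p.2 D₀ ≠ cnt d A q.2 D₀ → False := by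
    intro A hA D₀ hD₀ hneA
    obtain ⟨l₀, hl₀, hupA⟩ := lex_top_of_dominant hlex hab hp hq hA (exists_diff_of_cnt_ne hneA)
    -- the top of `A` is at least `D₀ > h`
    have hTA : h < d l₀ := by
      by_contra hc
      push Not at hc
      exact hneA (hupA D₀ (lt_of_le_of_lt hc hD₀))
    have hAc := image_compl_eq (p := p) (q := q) hA
    by_cases hc : ∀ D, cnt d Aᶜ p.2 D = cnt d Aᶜ q.2 D
    · -- complement silent: the global count differs at the top of `A`
      have := habove (d l₀) hTA
      rw [← cnt_add_compl d A p.2, ← cnt_add_compl d A q.2, hc] at this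
      omega
    · push Not at hc
      obtain ⟨D₁, hD₁⟩ := hc
      obtain ⟨l₁, hl₁, hupB⟩ := lex_top_of_dominant hlex hab hp hq hAc (exists_diff_of_cnt_ne hD₁)
      rcases lt_trichotomy (d l₀) (d l₁) with hlt | heq | hgt
      · -- top of the complement is higher: global differs there
        have e1 := hupA (d l₁) hlt
        have := habove (d l₁) (hTA.trans hlt)
        rw [← cnt_add_compl d A p.2, ← cnt_add_compl d A q.2, e1] at this
        omega
      · have := habove (d l₀) hTA
        rw [← cnt_add_compl d A p.2, ← cnt_add_compl d A q.2] at this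
        rw [← heq] at hl₁
        omega
      · have e1 := hupB (d l₀) hgt
        have := habove (d l₀) hTA
        rw [← cnt_add_compl d A p.2, ← cnt_add_compl d A q.2, e1] at this
        omega
  intro D hD
  by_contra hc
  exact key hW D hD hc

/-- **THE LEADING ORBIT IS UNIQUE**: if in addition `q` has exactly one more column of the leading value `h` than `p`, then an
invariant column set and its complement cannot BOTH change their count at `h`. [statement of the cell] -/
theorem not_both_lead (hlex : ∀ l l', d l < d l' → m * d l < d l') {θa θb : ℤ} (hab : θa < θb)
    {p q : Equiv.Perm (Fin m) × (Fin m → Fin K)} (hp : IsDominant d v ε θa p) (hq : IsDominant d v ε θb q)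
    {h : ℕ} (habove : ∀ D, h < D → cnt d univ p.2 D = cnt d univ q.2 D) (hlead : cnt d univ q.2 h = cnt d univ p.2 h + 1)
    {W : Finset (Fin m)} (hW : W.image p.1 = W.image q.1) :
    cnt d W p.2 h = cnt d W q.2 h ∨ cnt d Wᶜ p.2 h = cnt d Wᶜ q.2 h := by
  by_contra hc
  push Not at hc
  obtain ⟨h1, h2⟩ := hc
  have hWc := image_compl_eq (p := p) (q := q) hW
  -- on each side the top differing value is `h` itself (it cannot be above `h` by `cnt_eq_above`), hence `q` leads on both sides
  have side : ∀ {A : Finset (Fin m)}, A.image p.1 = A.image q.1 → cnt d A p.2 h ≠ cnt d A q.2 h →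
      cnt d A p.2 h < cnt d A q.2 h := by
    intro A hA hneA
    obtain ⟨l₀, hl₀, hupA⟩ := lex_top_of_dominant hlex hab hp hq hA (exists_diff_of_cnt_ne hneA)
    have hup := cnt_eq_above hlex hab hp hq habove hA
    rcases lt_trichotomy (d l₀) h with hlt | heq | hgt
    · exact absurd (hupA h hlt) hneA
    · rw [heq] at hl₀; exact hl₀
    · exact absurd (hup (d l₀) hgt) hl₀.ne
  have a := side hW h1
  have b := side hWc h2
  have := hlead
  rw [← cnt_add_compl d W p.2, ← cnt_add_compl d W q.2] at this
  omega

/-- **SINGLE-CYCLE CARRY LAW (dichotomy form).**  `p ≺ q` dominant, values super-increasing; the profiles agree above `h`, `q` has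
exactly one more column of value `h`, and every column of `q` of value `< h` sits at the floor value `d₀ ≤ d l` (a FULL CARRY into
`h`, or a unit step of the lowest digit).  Then for every invariant column set `W`, the two terms agree (row and class) on all of
`W` or on all of its complement: the change cannot be split by an invariant cut. [statement of the cell] -/
theorem carry_dichotomy (hlex : ∀ l l', d l < d l' → m * d l < d l') {θa θb : ℤ} (hab : θa < θb)
    {p q : Equiv.Perm (Fin m) × (Fin m → Fin K)} (hp : IsDominant d v ε θa p) (hq : IsDominant d v ε θb q)
    {h : ℕ} (habove : ∀ D, h < D → cnt d univ p.2 D = cnt d univ q.2 D) (hlead : cnt d univ q.2 h = cnt d univ p.2 h + 1)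
    {d₀ : ℕ} (hmin : ∀ l, d₀ ≤ d l) (hfloor : ∀ i, d (q.2 i) < h → d (q.2 i) = d₀)
    {W : Finset (Fin m)} (hW : W.image p.1 = W.image q.1) :
    (∀ i ∈ W, p.1 i = q.1 i ∧ p.2 i = q.2 i) ∨ (∀ i ∈ Wᶜ, p.1 i = q.1 i ∧ p.2 i = q.2 i) := by
  by_contra hc
  push Not at hc
  obtain ⟨⟨i, hi, hdi⟩, ⟨j, hj, hdj⟩⟩ := hc
  have hdi' : p.1 i ≠ q.1 i ∨ p.2 i ≠ q.2 i := by
    by_cases h1 : p.1 i = q.1 i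
    · exact Or.inr (hdi h1)
    · exact Or.inl h1
  have hdj' : p.1 j ≠ q.1 j ∨ p.2 j ≠ q.2 j := by
    by_cases h1 : p.1 j = q.1 j
    · exact Or.inr (hdj h1)
    · exact Or.inl h1
  have hWc := image_compl_eq (p := p) (q := q) hW
  -- a side whose top differing value is BELOW `h` is impossible (floor + cardinality)
  have low : ∀ {A : Finset (Fin m)}, A.image p.1 = A.image q.1 → (∃ i ∈ A, p.1 i ≠ q.1 i ∨ p.2 i ≠ q.2 i) →
      cnt d A p.2 h < cnt d A q.2 h := by
    intro A hA hdA
    obtain ⟨l₀, hl₀, hupA⟩ := lex_top_of_dominant hlex hab hp hq hA hdA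
    have hup := cnt_eq_above hlex hab hp hq habove hA
    rcases lt_trichotomy (d l₀) h with hlt | heq | hgt
    · exfalso
      -- `q` has a column of value `d l₀ < h` in `A`, so `d l₀ = d₀` is the floor
      have hpos : 0 < cnt d A q.2 (d l₀) := lt_of_le_of_lt (Nat.zero_le _) hl₀
      obtain ⟨i₁, hi₁⟩ := card_pos.1 hpos
      have hfl : d l₀ = d₀ := by
        have e := (mem_filter.1 hi₁).2
        rw [← e]; exact hfloor i₁ (e ▸ hlt)
      -- cardinality: |A| = floor count + counts above the floor, for both class maps
      have csum : ∀ r : Fin m → Fin K, A.card = cnt d A r (d l₀) +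
          ∑ D ∈ (univ.image d).filter (fun D => d l₀ < D), cnt d A r D := by
        intro r
        rw [card_eq_sum_cnt d A r, ← sum_filter_add_sum_filter_not (univ.image d) (fun D => d l₀ < D), add_comm]
        congr 1
        have : (univ.image d).filter (fun D => ¬ d l₀ < D) = {d l₀} := by
          ext D
          simp only [mem_filter, mem_image, mem_univ, true_and, mem_singleton, not_lt]
          constructor
          · rintro ⟨⟨l, rfl⟩, hle⟩
            exact le_antisymm hle (hfl ▸ hmin l)
          · rintro rfl; exact ⟨⟨l₀, rfl⟩, le_rfl⟩
        rw [this, sum_singleton]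
      have e1 := csum p.2
      have e2 := csum q.2
      have e3 : ∑ D ∈ (univ.image d).filter (fun D => d l₀ < D), cnt d A p.2 D =
          ∑ D ∈ (univ.image d).filter (fun D => d l₀ < D), cnt d A q.2 D :=
        sum_congr rfl fun D hD => hupA D (mem_filter.1 hD).2
      omega
    · rw [heq] at hl₀; exact hl₀
    · exact absurd (hup (d l₀) hgt) hl₀.ne
  have a := low hW ⟨i, hi, hdi'⟩
  have b := low hWc ⟨j, hj, hdj'⟩
  have := hlead
  rw [← cnt_add_compl d W p.2, ← cnt_add_compl d W q.2] at this
  omega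

/-! ## 5. Corollaries: frozen blocks, middle columns, the single orbit -/

/-- **FROZEN BLOCKS.**  Under the hypotheses of `carry_dichotomy`, an invariant block that misses one changed column is pointwise
frozen (same rows, same classes): during a full carry nothing can happen on the side. [statement of the cell] -/
theorem carry_block_frozen (hlex : ∀ l l', d l < d l' → m * d l < d l') {θa θb : ℤ} (hab : θa < θb)
    {p q : Equiv.Perm (Fin m) × (Fin m → Fin K)} (hp : IsDominant d v ε θa p) (hq : IsDominant d v ε θb q)
    {h : ℕ} (habove : ∀ D, h < D → cnt d univ p.2 D = cnt d univ q.2 D) (hlead : cnt d univ q.2 h = cnt d univ p.2 h + 1)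
    {d₀ : ℕ} (hmin : ∀ l, d₀ ≤ d l) (hfloor : ∀ i, d (q.2 i) < h → d (q.2 i) = d₀)
    {W : Finset (Fin m)} (hW : W.image p.1 = W.image q.1) {j : Fin m} (hj : j ∉ W) (hdj : p.1 j ≠ q.1 j ∨ p.2 j ≠ q.2 j) :
    ∀ i ∈ W, p.1 i = q.1 i ∧ p.2 i = q.2 i := by
  rcases carry_dichotomy hlex hab hp hq habove hlead hmin hfloor hW with hc | hc
  · exact hc
  · obtain ⟨h1, h2⟩ := hc j (mem_compl.2 hj)
    rcases hdj with hd | hd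
    · exact absurd h1 hd
    · exact absurd h2 hd

/-- **MIDDLE COLUMNS CHANGE.**  In a full carry every column of `p` with a middle value (`d₀ < · < h`) changes its class (so, by
`carry_dichotomy`, lies in the carry's orbit). [folklore] -/
theorem middle_changes {p q : Equiv.Perm (Fin m) × (Fin m → Fin K)} {h d₀ : ℕ}
    (hfloor : ∀ i, d (q.2 i) < h → d (q.2 i) = d₀) {i : Fin m} (h1 : d₀ < d (p.2 i)) (h2 : d (p.2 i) < h) :
    p.2 i ≠ q.2 i := by
  intro he
  have := hfloor i (he ▸ h2)
  rw [← he] at this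
  omega

/-- **SINGLE ORBIT.**  Under the hypotheses of `carry_dichotomy`, all columns where `p` and `q` differ lie in ONE orbit of
`σ_p⁻¹ σ_q`: there is a column `i₀` such that the two terms agree at every column outside the `SameCycle` class of `i₀`.
[statement of the cell] -/
theorem carry_single_orbit (hlex : ∀ l l', d l < d l' → m * d l < d l') {θa θb : ℤ} (hab : θa < θb)
    {p q : Equiv.Perm (Fin m) × (Fin m → Fin K)} (hp : IsDominant d v ε θa p) (hq : IsDominant d v ε θb q)
    {h : ℕ} (habove : ∀ D, h < D → cnt d univ p.2 D = cnt d univ q.2 D) (hlead : cnt d univ q.2 h = cnt d univ p.2 h + 1)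
    {d₀ : ℕ} (hmin : ∀ l, d₀ ≤ d l) (hfloor : ∀ i, d (q.2 i) < h → d (q.2 i) = d₀) :
    ∃ i₀ : Fin m, ∀ i, ¬ (p.1⁻¹ * q.1).SameCycle i₀ i → p.1 i = q.1 i ∧ p.2 i = q.2 i := by
  classical
  by_cases hall : ∀ i, p.1 i = q.1 i ∧ p.2 i = q.2 i
  · rcases Nat.eq_zero_or_pos m with hm | hm
    · subst hm
      -- no columns at all: the global count identity `hlead` is impossible, but we do not even need that
      exact absurd hlead (by unfold cnt; simp)
    · exact ⟨⟨0, hm⟩, fun i _ => hall i⟩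
  push Not at hall
  obtain ⟨i₀, hi₀⟩ := hall
  refine ⟨i₀, ?_⟩
  set π : Equiv.Perm (Fin m) := p.1⁻¹ * q.1 with hπ
  set W : Finset (Fin m) := univ.filter (fun i => π.SameCycle i₀ i) with hWdef
  -- `W` is invariant: `q.1 = p.1 ∘ π` and `π` preserves the cycle class of `i₀`
  have hW : W.image p.1 = W.image q.1 := by
    ext a
    simp only [mem_image, hWdef, mem_filter, mem_univ, true_and]
    constructor
    · rintro ⟨i, hi, rfl⟩
      refine ⟨π⁻¹ i, ?_, ?_⟩
      · exact (Equiv.Perm.sameCycle_symm_apply_right).2 hi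
      · rw [hπ]; simp
    · rintro ⟨i, hi, rfl⟩
      refine ⟨π i, (Equiv.Perm.sameCycle_apply_right).2 hi, ?_⟩
      rw [hπ]; simp
  have hi₀W : i₀ ∈ W := mem_filter.2 ⟨mem_univ _, Equiv.Perm.SameCycle.refl _ _⟩
  rcases carry_dichotomy hlex hab hp hq habove hlead hmin hfloor hW with hc | hc
  · obtain ⟨h1, h2⟩ := hc i₀ hi₀W
    exact absurd h2 (hi₀ h1)
  · intro i hi
    exact hc i (mem_compl.2 fun hW' => hi (mem_filter.1 hW').2)

end CarryCycle

end Summit.ValiantsHypothesis.ValiantsHypothesis.Theorems.KPlusLogSqLaw
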